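import Literature.AlgebraicGeometry.Resolution.MarkedIdealsEtale
import Literature.AlgebraicGeometry.Resolution.AlterationsSectionDivisor
import HarnessLib

/-!
# The order of an ideal sheaf restricted to a closed subscheme

Topic `Literature/AlgebraicGeometry/Resolution`. For a morphism `τ : Y ⟶ X` whose stalk maps are SURJECTIVE (e.g. a closed
immersion) and an ideal sheaf `𝓘` on `X`, the order of the restricted ideal sheaf `𝓘·𝒪_Y = 𝓘.comap τ` (Mathlib
`Scheme.IdealSheafData.comap`) at a point `y` is read off on `X`:

* `le_idealOrder_comap_iff_of_stalkMap_surjective` — `n ≤ ord_y(𝓘·𝒪_Y) ↔ 𝓘_{τ y} ⊆ 𝔪_{τ y}^n + ker(𝒪_{X,τ y} → 𝒪_{Y,y})`;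
* `le_idealOrder_comap_iff_of_isClosedImmersion` — for a closed immersion the kernel is the stalk of the ideal sheaf `ker τ`
  (tree `stalkIdeal_ker_eq_ker_stalkMap`): `n ≤ ord_y(𝓘·𝒪_Y) ↔ 𝓘_{τ y} ⊆ 𝔪_{τ y}^n + (ker τ)_{τ y}`;
* `mem_range_of_ker_pow_le_of_le_idealOrder`, `setOf_le_idealOrder_subset_image`, `setOf_le_idealOrder_eq_image`
  — for `J ⊇ (ker τ)^b` (`b ≠ 0`) and `I′ ≤ J·𝒪_Y`: `{ord J ≥ b} ⊆ τ({ord I′ ≥ b})`, with equality given the converse bound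
  pointwise (the centre test of an extension of an ideal from the closed subscheme `Y`, split into its formal and its
  model-specific half).

Ingredients: the stalk of a pulled-back ideal sheaf is the extension of the stalk (`stalkIdeal_comap_eq_map`, any morphism); a
surjective local homomorphism of local rings maps the maximal ideal ONTO the maximal ideal (Mathlib
`IsLocalRing.map_maximalIdeal_of_surjective`); `f⁻¹(f(J)) = J + ker f`. Bearing (index only): the res-hironaka campaign's
AR-extension thread (Q-03-006) reads the centre test of an extension `J ⊇ 𝓘_Y^b` of an ideal on a closed `Y ⊂ X` in this
form. Elementary; [folklore] throughout, stated for BGMW's order function `idealOrder` of the tree.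
[BierstoneGrigorievMilmanWlodarczyk2011] §3.1 (order of an ideal sheaf at a point).
-/

noncomputable section

namespace Literature.AlgebraicGeometry.Resolution

open CategoryTheory _root_.AlgebraicGeometry IsLocalRing

universe u

/-- For a SURJECTIVE homomorphism `f : R → S` of local rings and ideals `J ⊆ R`, `n`:
`f(J) ⊆ 𝔪_S^n ↔ J ⊆ 𝔪_R^n + ker f` (`f(𝔪_R) = 𝔪_S`). [cite: BierstoneGrigorievMilmanWlodarczyk2011, §3.1 p. 6 (order of an ideal at a point; elementary bookkeeping for restriction to a closed subscheme)] -/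
theorem map_le_maximalIdeal_pow_iff_of_surjective {R S : Type*} [CommRing R] [CommRing S] [IsLocalRing R]
    [IsLocalRing S] (f : R →+* S) (hf : Function.Surjective f) (J : Ideal R) (n : ℕ) :
    J.map f ≤ maximalIdeal S ^ n ↔ J ≤ maximalIdeal R ^ n ⊔ RingHom.ker f := by
  rw [← map_maximalIdeal_of_surjective f hf, ← Ideal.map_pow, Ideal.map_le_iff_le_comap,
    Ideal.comap_map_of_surjective f hf, ← RingHom.ker_eq_comap_bot]

/-- **Order of a restricted ideal sheaf, surjective stalk maps**: for `τ : Y ⟶ X` with `𝒪_{X,τ y} → 𝒪_{Y,y}` surjective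
(e.g. a closed immersion), `n ≤ ord_y(𝓘.comap τ) ↔ 𝓘_{τ y} ⊆ 𝔪_{τ y}^n + ker(𝒪_{X,τ y} → 𝒪_{Y,y})`.
[cite: BierstoneGrigorievMilmanWlodarczyk2011, §3.1 p. 6 (order of an ideal at a point; elementary bookkeeping for restriction to a closed subscheme)] -/
theorem le_idealOrder_comap_iff_of_stalkMap_surjective {X Y : Scheme.{u}} (τ : Y ⟶ X) (I : X.IdealSheafData)
    (y : Y) (hτ : Function.Surjective (τ.stalkMap y).hom) (n : ℕ) :
    (n : ℕ∞) ≤ idealOrder (I.comap τ) y ↔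
      stalkIdeal I (τ y) ≤ maximalIdeal (X.presheaf.stalk (τ y)) ^ n ⊔ RingHom.ker (τ.stalkMap y).hom := by
  rw [le_idealOrder_iff, stalkIdeal_comap_eq_map, map_le_maximalIdeal_pow_iff_of_surjective _ hτ]

/-- **Order of an ideal sheaf restricted to a closed subscheme**: for a closed immersion `τ : Y ⟶ X` with ideal sheaf
`ker τ`, an ideal sheaf `𝓘` on `X`, `y ∈ Y` and `n`: `n ≤ ord_y(𝓘.comap τ) ↔ 𝓘_{τ y} ⊆ 𝔪_{τ y}^n + (ker τ)_{τ y}`.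
[cite: BierstoneGrigorievMilmanWlodarczyk2011, §3.1 p. 6 (order of an ideal at a point; elementary bookkeeping for restriction to a closed subscheme)] -/
theorem le_idealOrder_comap_iff_of_isClosedImmersion {X Y : Scheme.{u}} (τ : Y ⟶ X) [IsClosedImmersion τ]
    (I : X.IdealSheafData) (y : Y) (n : ℕ) :
    (n : ℕ∞) ≤ idealOrder (I.comap τ) y ↔
      stalkIdeal I (τ y) ≤ maximalIdeal (X.presheaf.stalk (τ y)) ^ n ⊔ stalkIdeal τ.ker (τ y) := by
  rw [le_idealOrder_comap_iff_of_stalkMap_surjective τ I y (τ.stalkMap_surjective y) n,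
    stalkIdeal_ker_eq_ker_stalkMap τ y]

/-! ### The locus of order `≥ b` of an ideal sheaf `J ⊇ (ker τ)^b` along a closed immersion `τ` -/

/-- **An ideal sheaf containing `(ker τ)^b`, `b ≠ 0`, has order `≥ b` only on the image of the closed immersion `τ`**: at
`x ∉ τ(Y) = supp(𝒪/ker τ)` the stalk `(ker τ)_x` is the unit ideal, so `J_x ⊇ (ker τ)_x^b = 𝒪_{X,x} ⊄ 𝔪_x^b`.
[cite: BierstoneGrigorievMilmanWlodarczyk2011, §3.1 p. 6 (order and support of an ideal sheaf; elementary bookkeeping for an extension of an ideal from a closed subscheme)] -/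
theorem mem_range_of_ker_pow_le_of_le_idealOrder {X Y : Scheme.{u}} (τ : Y ⟶ X) [IsClosedImmersion τ]
    {J : X.IdealSheafData} {b : ℕ} (hb : b ≠ 0) (hJ : τ.ker ^ b ≤ J) {x : X} (hx : (b : ℕ∞) ≤ idealOrder J x) :
    x ∈ Set.range τ := by
  by_contra hxr
  have hxs : x ∉ τ.ker.support := by
    intro h
    have h' : x ∈ (τ.ker.support : Set X) := h
    rw [Scheme.Hom.support_ker, τ.isClosedEmbedding.isClosed_range.closure_eq] at h'
    exact hxr h'
  have htop : stalkIdeal τ.ker x = ⊤ := by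
    by_contra h
    exact hxs ((mem_support_iff_stalkIdeal_le τ.ker x).mpr (IsLocalRing.le_maximalIdeal h))
  rw [le_idealOrder_iff] at hx
  have h1 : (⊤ : Ideal (X.presheaf.stalk x)) ≤ maximalIdeal (X.presheaf.stalk x) := by
    calc (⊤ : Ideal (X.presheaf.stalk x)) = stalkIdeal (τ.ker ^ b) x := by rw [stalkIdeal_pow, htop, Ideal.top_pow]
      _ ≤ stalkIdeal J x := stalkIdeal_mono hJ x
      _ ≤ maximalIdeal (X.presheaf.stalk x) ^ b := hx
      _ ≤ maximalIdeal (X.presheaf.stalk x) := Ideal.pow_le_self hb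
  exact (maximalIdeal.isMaximal (X.presheaf.stalk x)).ne_top (top_le_iff.mp h1)

/-- **`{ord(J) ≥ b} ⊆ τ({ord(I′) ≥ b})`** for a closed immersion `τ : Y ⟶ X`, an ideal sheaf `J ⊇ (ker τ)^b` on `X` (`b ≠ 0`) and
any ideal sheaf `I′ ≤ J·𝒪_Y` on `Y` (e.g. `I′ = J.comap τ`): a point of order `≥ b` for `J` is `τ y` with `ord_y(I′) ≥ b`
(`ord_y(J·𝒪_Y) ≥ ord_{τ y}(J)`, tree `idealOrder_le_idealOrder_comap`, and `I′ ≤ J·𝒪_Y`; orders are antitone in the ideal, cf. `Kollar2007.Triple.idealOrder_anti`). This is the half of the centre test of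
an extension that holds for EVERY such `J`, at every point, over any base.
[cite: BierstoneGrigorievMilmanWlodarczyk2011, §3.1 p. 6 (order and support of an ideal sheaf; elementary bookkeeping for an extension of an ideal from a closed subscheme)] -/
theorem setOf_le_idealOrder_subset_image {X Y : Scheme.{u}} (τ : Y ⟶ X) [IsClosedImmersion τ] {J : X.IdealSheafData}
    {b : ℕ} (hb : b ≠ 0) (hJ : τ.ker ^ b ≤ J) {I' : Y.IdealSheafData} (hI' : I' ≤ J.comap τ) :
    {x | (b : ℕ∞) ≤ idealOrder J x} ⊆ τ '' {y | (b : ℕ∞) ≤ idealOrder I' y} := by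
  intro x hx
  obtain ⟨y, rfl⟩ := mem_range_of_ker_pow_le_of_le_idealOrder τ hb hJ hx
  refine ⟨y, ?_, rfl⟩
  have h := hx.trans (idealOrder_le_idealOrder_comap τ J y)
  rw [le_idealOrder_iff] at h
  rw [Set.mem_setOf_eq, le_idealOrder_iff]
  exact (stalkIdeal_mono hI' y).trans h

/-- **`{ord(J) ≥ b} = τ({ord(I′) ≥ b})`** as soon as, in addition, `ord_y(I′) ≥ b ⇒ ord_{τ y}(J) ≥ b` for all `y` — the
model-specific half (for the natural extension `J^♮` of a smooth pair over a perfect field at closed points: campaign file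
`Hironaka2017/Lib/NaturalExtOrderSubscheme.lean`; for Taylor-ideal models: an order bound by arithmetic).
[cite: BierstoneGrigorievMilmanWlodarczyk2011, §3.1 p. 6 (order and support of an ideal sheaf; elementary bookkeeping for an extension of an ideal from a closed subscheme)] -/
theorem setOf_le_idealOrder_eq_image {X Y : Scheme.{u}} (τ : Y ⟶ X) [IsClosedImmersion τ] {J : X.IdealSheafData}
    {b : ℕ} (hb : b ≠ 0) (hJ : τ.ker ^ b ≤ J) {I' : Y.IdealSheafData} (hI' : I' ≤ J.comap τ)
    (hUB : ∀ y : Y, (b : ℕ∞) ≤ idealOrder I' y → (b : ℕ∞) ≤ idealOrder J (τ y)) :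
    {x | (b : ℕ∞) ≤ idealOrder J x} = τ '' {y | (b : ℕ∞) ≤ idealOrder I' y} := by
  refine Set.Subset.antisymm (setOf_le_idealOrder_subset_image τ hb hJ hI') ?_
  rintro _ ⟨y, hy, rfl⟩
  exact hUB y hy

end Literature.AlgebraicGeometry.Resolution

end
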